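import Summits.Langlands.Langlands.Theorems.IrreducibilityBySelfDualityReciprocityUpToIrreducibilityRamifiedPlaces
import Summits.Langlands.Langlands.Theorems.IrreducibilityBySelfDualityReciprocityUpToIrreducibilityRankOneFiniteOrder
import Literature.NumberTheory.GaloisRepresentations.HeckeCharacterCofiniteProofs
import HarnessLib

/-!
# Line `Sketch` for the crux `ReciprocityUpToIrreducibility` (item stmt-Langlands-14328), continuation c7:
# rank one at ALL places away from `ℓ` — both directions of the summit on the finite-order sector
# unramified above `ℓ`, for EVERY reciprocity datum, modulo Artin compatibility at the bad places

Support file (closes nothing; continuation lead c7, prover-line-stmt-Langlands-14328-c7-0).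

c4 proved the bodies of `AutomorphicToGalois 1 Rec hcpt` / `GaloisToAutomorphic 1 Rec hcpt` for every
`Rec` on the EVERYWHERE-unramified finite-order sector (`…RankOneFiniteOrder`).  With the ramified-place
equivalence of wave N7 (`rankOne_localGlobalCompatibleAt_away_iff_artinCompatible`, `…RamifiedPlaces`)
the hypothesis "unramified everywhere" drops to "unramified above `ℓ`" (blocker B1: the pinned `D_pst`
datum decides de Rham-ness only on the unramified sector), at the price of the EXACT residue of blocker
B2 in rank one, stated as an explicit hypothesis on `Rec`:

  (CFT_θ)  for every open-kernel `ρ : Γ_K → GL₁(ℚ̄_ℓ)` carrying the Frobenius data of `θ`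
           (unramified where `θ` is, `char ρ(Frob_v^{arith}) = X - ι⁻¹(θ(ϖ_v))⁻¹` there) and every place
           `v` where `θ` ramifies: `ι(tr ρ|_{Γ_{K_v}}(w)) = θ_v((Rec.llc v).artin w)` for all `w ∈ W_{K_v}`

— the local–global compatibility of `Rec`'s Artin maps with global class field theory on `θ` (for a
datum normalised against THE Artin map, `LocalArtinData.IsCanonical`: Tate's theorem; by Chebotarev the
`ρ` in (CFT_θ) is unique, `HeckeCharacter.framedArtinRep_unique`).

* `rankOne_corresponds_of_artinCompatible` — `Corresponds Rec ι π_θ ρ` for `θ` finite order unramified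
  above `ℓ`, `ρ` open-kernel with `θ`'s Frobenius data, given Artin compatibility at the ramified places
  of `θ` (good places: c4 `rankOne_localGlobalCompatibleAt_of_satakeFrobCompatibleAt`; bad places:
  `rankOne_localGlobalCompatibleAt_away_of_artinCompatible`, all `v ∤ ℓ` by hypothesis).
* `automorphicToGalois_glOne_of_artinCompatible` — the body of (A) at `π_θ` under (CFT_θ): the `ℓ`-adic
  avatar (`FramedArtinRep.lAdicAvatar` of `HeckeCharacter.exists_framedArtinRep_of_isFiniteOrder`, open
  kernel) is irreducible, pinned-geometric (unramified above `ℓ`), corresponds, unique up to conjugacy.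
* `galoisToAutomorphic_glOne_of_artinCompatible` — the body of (B) at an open-kernel geometric `ρ`
  unramified above `ℓ` under the mirror hypothesis (CFT_ρ) (Artin reciprocity
  `FramedGaloisRep.exists_heckeCharacter_of_isOpen_ker`, cuspidal model
  `stub_rankOne_cuspidalModel_of_isFiniteOrder`).

All under `FontaineDatumExists` (the `v ∣ ℓ` clause on the unramified sector, c3).  No definitions;
std axioms.
-/

noncomputable section

set_option linter.dupNamespace false -- project-wide option (lakefile weak.linter.dupNamespace); `Summit.Langlands.Langlands` is the mandated namespace

open scoped MatrixGroups Matrix NumberField Classical Polynomial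
open Filter IsDedekindDomain Field Polynomial
open Literature.NumberTheory.Automorphic Literature.NumberTheory.GaloisRepresentations
open Literature.NumberTheory.PAdicHodge
open Summit.Langlands
open Summit.Langlands.Langlands.Theorems.IrreducibleOffSector

namespace Summit.Langlands.Langlands.Theorems.ReciprocityUpToIrreducibility

variable {K : Type} [Field K] [NumberField K] {ℓ : ℕ} [Fact ℓ.Prime]

/-- The `ℓ`-adic avatar of a rank-one Artin representation has open kernel (the kernel of `ψ`).
[cite: SerreAbelianLadic1968, Ch. III §2.3] -/
theorem isOpen_ker_lAdicAvatar (ψ : FramedArtinRep K 1) (ι : PadicAlgCl ℓ ≃+* ℂ) :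
    IsOpen ((ψ.lAdicAvatar ι).toMonoidHom.ker : Set (absoluteGaloisGroup K)) := by
  have h : ((ψ.lAdicAvatar ι).toMonoidHom.ker : Set (absoluteGaloisGroup K)) =
      ((ψ.lAdicChar ι).ker : Set (absoluteGaloisGroup K)) := by
    ext σ
    simp only [SetLike.mem_coe, MonoidHom.mem_ker]
    exact FramedGaloisRep.ofOpenKer_apply_eq_one_iff (ψ.lAdicChar ι) (ψ.isOpen_ker_lAdicChar ι) σ
  rw [h]
  exact ψ.isOpen_ker_lAdicChar ι

/-- **Rank one, every `Rec`: `Corresponds` at ALL places for a finite-order `θ` unramified above `ℓ`,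
given Artin compatibility at the ramified places.**  Let `π = ℂ·(θ ∘ det)/⊥` and let
`ρ : Γ_K → GL₁(ℚ̄_ℓ)` have open kernel and carry the Frobenius data of `θ` (unramified wherever `θ`
is, with `char ρ(Frob_v^{arith}) = X - ι⁻¹(θ(ϖ_v))⁻¹` there).  If at every place where `θ` ramifies
`ι(tr ρ|_{Γ_{K_v}}(w)) = θ_v((Rec.llc v).artin w)` on `W_{K_v}`, then `Corresponds Rec ι π ρ`: Satake
compatibility at the cofinitely many unramified places of `θ` (`HeckeCharacter.isUnramifiedAt_cofinite_holds`),
local–global compatibility there by c4 (`rankOne_localGlobalCompatibleAt_of_satakeFrobCompatibleAt`,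
`v ∣ ℓ` included since `θ` is unramified above `ℓ`) and at the ramified places (all `v ∤ ℓ`) by
`rankOne_localGlobalCompatibleAt_away_of_artinCompatible`.
[cite: BuzzardGeeLMS2014, Conj. 3.2.1–3.2.2 (n = 1)] [cite: TateCorvallis1979, (4.2.1)]
[cite: CasselsFrohlichANT1967, Ch. VII §5.1 Main Theorem] -/
theorem rankOne_corresponds_of_artinCompatible
    (hF : FontaineDatumExists) {hcpt : isCompact_glFiniteIntegralLevel 1 K}
    (Rec : ReciprocityData K) (ι : PadicAlgCl ℓ ≃+* ℂ)
    {π : AutomorphicRepData (AutomorphyDatum.gl 1 K hcpt)} {θ : HeckeCharacter K}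
    (hW : π.W = Submodule.span ℂ {fun g : (AdelicGroupData.gl 1 K).Adelic => (detTwist 1 θ g : ℂ)})
    (hW' : π.W' = ⊥) (hθℓ : ∀ v : HeightOneSpectrum (𝓞 K), ((ℓ : ℕ) : 𝓞 K) ∈ v.asIdeal → θ.IsUnramifiedAt v)
    (ρ : FramedGaloisRep K (PadicAlgCl ℓ) 1)
    (hker : IsOpen (ρ.toMonoidHom.ker : Set (absoluteGaloisGroup K)))
    (hρ : ∀ v : HeightOneSpectrum (𝓞 K), θ.IsUnramifiedAt v →
      ρ.IsUnramifiedAt v ∧ ρ.HasFrobCharpolyAt v (X - C (ι.symm (θ.valueAtUniformizer v)⁻¹)))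
    (hcomp : ∀ v : HeightOneSpectrum (𝓞 K), ¬ θ.IsUnramifiedAt v →
      ∀ w : WeilGroup (v.adicCompletion K),
        (ι : PadicAlgCl ℓ →+* ℂ) ((((ρ.toLocal v).toWeilGroupHom w : GL (Fin 1) (PadicAlgCl ℓ)) :
            Matrix (Fin 1) (Fin 1) (PadicAlgCl ℓ)).trace) =
          ((θ.localComponent v ((Rec.llc v).artin.artin w) : ℂˣ) : ℂ)) :
    Corresponds Rec ι π ρ := by
  have hsat : ∀ v, θ.IsUnramifiedAt v → SatakeFrobCompatibleAt ι π ρ v := fun v hv =>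
    satakeFrobCompatibleAt_model_of_hasFrobCharpolyAt ι hW hW' ρ hv (hρ v hv).1 (hρ v hv).2
  have hcof : ∀ᶠ v : HeightOneSpectrum (𝓞 K) in cofinite, θ.IsUnramifiedAt v :=
    HeckeCharacter.isUnramifiedAt_cofinite_holds θ
  refine ⟨hcof.mono hsat, fun v => ?_⟩
  by_cases hv : θ.IsUnramifiedAt v
  · exact rankOne_localGlobalCompatibleAt_of_satakeFrobCompatibleAt hF Rec ι π θ
      (smul_char_of_detTwist_model hW) ρ hv (hsat v hv)
  · exact rankOne_localGlobalCompatibleAt_away_of_artinCompatible Rec ι π θ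
      (smul_char_of_detTwist_model hW) ρ (fun hℓv => hv (hθℓ v hℓv))
      (isContinuousRep_weilRestrict_toLocal_of_isOpen_ker ρ hker v) (hcomp v hv)

/-- **Direction (A) in rank one on the finite-order sector unramified above `ℓ`, for EVERY `Rec`,
modulo Artin compatibility at the bad places** (under `FontaineDatumExists`).  For a finite-order Hecke
character `θ` unramified above `ℓ` and its model `π_θ = ℂ·(θ ∘ det)/⊥`, IF `Rec`'s Artin maps are
compatible with class field theory on `θ` at its ramified places — hypothesis (CFT_θ): every open-kernel
`ρ` with `θ`'s Frobenius data satisfies `ι(tr ρ(w)) = θ_v((Rec.llc v).artin w)` on `W_{K_v}` there —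
then there is `ρ : Γ_K → GL₁(ℚ̄_ℓ)` irreducible, pinned-geometric, with `Corresponds Rec ι π_θ ρ`, unique
up to conjugacy: the body of `AutomorphicToGalois 1 Rec hcpt` at `π_θ`.  `ρ` is the `ℓ`-adic avatar of
the Artin character of `θ` (`HeckeCharacter.exists_framedArtinRep_of_isFiniteOrder`,
`FramedArtinRep.lAdicAvatar`, open kernel `FramedArtinRep.isOpen_ker_lAdicChar`); c4's
`automorphicToGalois_glOne_of_unramified` is the case without bad places.
[cite: BuzzardGeeLMS2014, Conj. 3.2.1–3.2.2 (n = 1)] [cite: CasselsFrohlichANT1967, Ch. VII §5.1 Main Theorem]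
[cite: DeligneSerreASENS1974, Lemme 3.2] -/
theorem automorphicToGalois_glOne_of_artinCompatible
    (hF : FontaineDatumExists) {hcpt : isCompact_glFiniteIntegralLevel 1 K}
    (Rec : ReciprocityData K) (ι : PadicAlgCl ℓ ≃+* ℂ)
    {π : AutomorphicRepData (AutomorphyDatum.gl 1 K hcpt)} {θ : HeckeCharacter K}
    (hW : π.W = Submodule.span ℂ {fun g : (AdelicGroupData.gl 1 K).Adelic => (detTwist 1 θ g : ℂ)})
    (hW' : π.W' = ⊥) (hfin : θ.IsFiniteOrder)
    (hθℓ : ∀ v : HeightOneSpectrum (𝓞 K), ((ℓ : ℕ) : 𝓞 K) ∈ v.asIdeal → θ.IsUnramifiedAt v)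
    (hCFT : ∀ ρ : FramedGaloisRep K (PadicAlgCl ℓ) 1,
      IsOpen (ρ.toMonoidHom.ker : Set (absoluteGaloisGroup K)) →
      (∀ v : HeightOneSpectrum (𝓞 K), θ.IsUnramifiedAt v →
        ρ.IsUnramifiedAt v ∧ ρ.HasFrobCharpolyAt v (X - C (ι.symm (θ.valueAtUniformizer v)⁻¹))) →
      ∀ v : HeightOneSpectrum (𝓞 K), ¬ θ.IsUnramifiedAt v →
        ∀ w : WeilGroup (v.adicCompletion K),
          (ι : PadicAlgCl ℓ →+* ℂ) ((((ρ.toLocal v).toWeilGroupHom w : GL (Fin 1) (PadicAlgCl ℓ)) :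
              Matrix (Fin 1) (Fin 1) (PadicAlgCl ℓ)).trace) =
            ((θ.localComponent v ((Rec.llc v).artin.artin w) : ℂˣ) : ℂ)) :
    ∃ ρ : FramedGaloisRep K (PadicAlgCl ℓ) 1,
      ρ.toGaloisRep.IsIrreducible ∧ IsGeometricFramed Rec ρ ∧ Corresponds Rec ι π ρ ∧
        ∀ ρ' : FramedGaloisRep K (PadicAlgCl ℓ) 1, Corresponds Rec ι π ρ' → IsConjugate ρ ρ' := by
  obtain ⟨ψ, hram, hfrob⟩ := θ.exists_framedArtinRep_of_isFiniteOrder hfin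
  have hker : IsOpen ((ψ.lAdicAvatar ι).toMonoidHom.ker : Set (absoluteGaloisGroup K)) :=
    isOpen_ker_lAdicAvatar ψ ι
  have hρ : ∀ v : HeightOneSpectrum (𝓞 K), θ.IsUnramifiedAt v →
      (ψ.lAdicAvatar ι).IsUnramifiedAt v ∧
        (ψ.lAdicAvatar ι).HasFrobCharpolyAt v (X - C (ι.symm (θ.valueAtUniformizer v)⁻¹)) :=
    fun v hv => ⟨(ψ.isUnramifiedAt_lAdicAvatar_iff ι v).mpr ((hram v).mpr hv),
      ψ.hasFrobCharpolyAt_lAdicAvatar ι (hfrob v hv)⟩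
  have hcorr : Corresponds Rec ι π (ψ.lAdicAvatar ι) :=
    rankOne_corresponds_of_artinCompatible hF Rec ι hW hW' hθℓ (ψ.lAdicAvatar ι) hker hρ
      (hCFT (ψ.lAdicAvatar ι) hker hρ)
  have hcof : ∀ᶠ v : HeightOneSpectrum (𝓞 K) in cofinite, θ.IsUnramifiedAt v :=
    HeckeCharacter.isUnramifiedAt_cofinite_holds θ
  have hgeo : IsGeometricFramed Rec (ψ.lAdicAvatar ι) :=
    ⟨hcof.mono fun v hv => (hρ v hv).1,
      fun v hv => isDeRhamFramed_fontainePstAdicCompletion_of_isUnramifiedAt _ v hv (hρ v (hθℓ v hv)).1⟩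
  exact ⟨ψ.lAdicAvatar ι, isIrreducible_of_rank_one _, hgeo, hcorr, fun ρ' h' =>
    isConjugate_of_satakeFrobCompatibleAt π ι (isIrreducible_of_rank_one _) hcorr.1 h'.1⟩

/-- **Direction (B) in rank one on the open-kernel sector unramified above `ℓ`, for EVERY `Rec`,
modulo Artin compatibility at the bad places** (under `FontaineDatumExists`).  Let
`ρ : Γ_K → GL₁(ℚ̄_ℓ)` have open kernel, be unramified at all but finitely many places and at every
`v ∣ ℓ`.  IF for every finite-order Hecke character `χ` carrying the Frobenius data of `ρ` (unramified
where `ρ` is, `char ρ(Frob_v^{arith}) = X - ι⁻¹(χ(ϖ_v))⁻¹` there) `Rec`'s Artin maps are compatible on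
`(χ_v, ρ|_{W_{K_v}})` at the ramified places of `ρ` — hypothesis (CFT_ρ) — then some cuspidal
L-algebraic `π` of `GL₁(𝔸_K)` has `Corresponds Rec ι π ρ`: the body of `GaloisToAutomorphic 1 Rec hcpt`
at `ρ` (Artin reciprocity `FramedGaloisRep.exists_heckeCharacter_of_isOpen_ker`, cuspidal model
`stub_rankOne_cuspidalModel_of_isFiniteOrder`, `rankOne_corresponds_of_artinCompatible` with the roles
of "unramified for `χ`" and "unramified for `ρ`" aligned at the places where `ρ` is unramified).
c4's `galoisToAutomorphic_glOne_of_isOpen_ker` is the case without bad places.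
[cite: FontaineMazurGeometric1995, Conj. 1 (n = 1)] [cite: CasselsFrohlichANT1967, Ch. VII §5.1 Main Theorem]
[cite: BuzzardGeeLMS2014, Conj. 3.2.2 (n = 1)] -/
theorem galoisToAutomorphic_glOne_of_artinCompatible
    (hF : FontaineDatumExists) (hcpt : isCompact_glFiniteIntegralLevel 1 K)
    (Rec : ReciprocityData K) (ι : PadicAlgCl ℓ ≃+* ℂ) (ρ : FramedGaloisRep K (PadicAlgCl ℓ) 1)
    (hker : IsOpen (ρ.toMonoidHom.ker : Set (absoluteGaloisGroup K)))
    (hae : ∀ᶠ v : HeightOneSpectrum (𝓞 K) in cofinite, ρ.IsUnramifiedAt v)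
    (hρℓ : ∀ v : HeightOneSpectrum (𝓞 K), ((ℓ : ℕ) : 𝓞 K) ∈ v.asIdeal → ρ.IsUnramifiedAt v)
    (hCFT : ∀ χ : HeckeCharacter K, χ.IsFiniteOrder →
      (∀ v : HeightOneSpectrum (𝓞 K), ρ.IsUnramifiedAt v →
        χ.IsUnramifiedAt v ∧ ρ.HasFrobCharpolyAt v (X - C (ι.symm (χ.valueAtUniformizer v)⁻¹))) →
      ∀ v : HeightOneSpectrum (𝓞 K), ¬ ρ.IsUnramifiedAt v →
        ∀ w : WeilGroup (v.adicCompletion K),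
          (ι : PadicAlgCl ℓ →+* ℂ) ((((ρ.toLocal v).toWeilGroupHom w : GL (Fin 1) (PadicAlgCl ℓ)) :
              Matrix (Fin 1) (Fin 1) (PadicAlgCl ℓ)).trace) =
            ((χ.localComponent v ((Rec.llc v).artin.artin w) : ℂˣ) : ℂ)) :
    ∃ π : CuspidalAutomorphicRepData 1 K hcpt, π.1.IsLAlgebraic ∧ Corresponds Rec ι π.1 ρ := by
  obtain ⟨χ, -, hfin, hχ⟩ := ρ.exists_heckeCharacter_of_isOpen_ker hker ι
  obtain ⟨π, hW, hW', hL⟩ := stub_rankOne_cuspidalModel_of_isFiniteOrder K hcpt χ hfin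
  have hsat : ∀ v, ρ.IsUnramifiedAt v → SatakeFrobCompatibleAt ι π.1 ρ v := fun v hv =>
    satakeFrobCompatibleAt_model_of_hasFrobCharpolyAt ι hW hW' ρ (hχ v hv).1 hv (hχ v hv).2
  refine ⟨π, hL, hae.mono hsat, fun v => ?_⟩
  by_cases hv : ρ.IsUnramifiedAt v
  · exact rankOne_localGlobalCompatibleAt_of_satakeFrobCompatibleAt hF Rec ι π.1 χ
      (smul_char_of_detTwist_model hW) ρ (hχ v hv).1 (hsat v hv)
  · exact rankOne_localGlobalCompatibleAt_away_of_artinCompatible Rec ι π.1 χ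
      (smul_char_of_detTwist_model hW) ρ (fun hℓv => hv (hρℓ v hℓv))
      (isContinuousRep_weilRestrict_toLocal_of_isOpen_ker ρ hker v) (hCFT χ hfin hχ v hv)

/-- **Registered stub `stub_automorphicToGalois_glOne_of_artinCompatible` of line `Sketch` (crux
stmt-Langlands-14328, c7 wave N7 assembly), closed form of `automorphicToGalois_glOne_of_artinCompatible`**:
direction (A) of the summit in rank one at `π_θ` (`θ` finite order, unramified above `ℓ`) for EVERY `Rec`,
under `FontaineDatumExists` and the Artin-compatibility hypothesis (CFT_θ) at the ramified places.
[cite: BuzzardGeeLMS2014, Conj. 3.2.1–3.2.2 (n = 1)] [cite: CasselsFrohlichANT1967, Ch. VII §5.1 Main Theorem] -/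
theorem stub_automorphicToGalois_glOne_of_artinCompatible :
    FontaineDatumExists → ∀ (K : Type) [Field K] [NumberField K] (ℓ : ℕ) [Fact ℓ.Prime]
      (hcpt : isCompact_glFiniteIntegralLevel 1 K) (Rec : ReciprocityData K) (ι : PadicAlgCl ℓ ≃+* ℂ)
      (π : AutomorphicRepData (AutomorphyDatum.gl 1 K hcpt)) (θ : HeckeCharacter K),
      π.W = Submodule.span ℂ {fun g : (AdelicGroupData.gl 1 K).Adelic => (detTwist 1 θ g : ℂ)} →
      π.W' = ⊥ → θ.IsFiniteOrder →
      (∀ v : HeightOneSpectrum (𝓞 K), ((ℓ : ℕ) : 𝓞 K) ∈ v.asIdeal → θ.IsUnramifiedAt v) →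
      (∀ ρ : FramedGaloisRep K (PadicAlgCl ℓ) 1,
        IsOpen (ρ.toMonoidHom.ker : Set (Field.absoluteGaloisGroup K)) →
        (∀ v : HeightOneSpectrum (𝓞 K), θ.IsUnramifiedAt v →
          ρ.IsUnramifiedAt v ∧ ρ.HasFrobCharpolyAt v (X - C (ι.symm (θ.valueAtUniformizer v)⁻¹))) →
        ∀ v : HeightOneSpectrum (𝓞 K), ¬ θ.IsUnramifiedAt v →
          ∀ w : WeilGroup (v.adicCompletion K),
            (ι : PadicAlgCl ℓ →+* ℂ) ((((ρ.toLocal v).toWeilGroupHom w : GL (Fin 1) (PadicAlgCl ℓ)) :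
                Matrix (Fin 1) (Fin 1) (PadicAlgCl ℓ)).trace) =
              ((θ.localComponent v ((Rec.llc v).artin.artin w) : ℂˣ) : ℂ)) →
      ∃ ρ : FramedGaloisRep K (PadicAlgCl ℓ) 1,
        ρ.toGaloisRep.IsIrreducible ∧ IsGeometricFramed Rec ρ ∧ Corresponds Rec ι π ρ ∧
          ∀ ρ' : FramedGaloisRep K (PadicAlgCl ℓ) 1, Corresponds Rec ι π ρ' → IsConjugate ρ ρ' :=
  fun hF _ _ _ _ _ _ Rec ι _ _ hW hW' hfin hθℓ hCFT =>
    automorphicToGalois_glOne_of_artinCompatible hF Rec ι hW hW' hfin hθℓ hCFT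

end Summit.Langlands.Langlands.Theorems.ReciprocityUpToIrreducibility

end
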